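import Summits.CriticalPhenomena.SAWScalingLimit.Theorems.SAWDefectDecoherenceBoundaryClosureRBoundaryExactnessZigzag
import Summits.CriticalPhenomena.SAWScalingLimit.Theorems.SAWDevelopingMapPotentialExistsTopology
import HarnessLib

/-!
# Boundary bookkeeping, IV: combinatorics of the boundary-site graph at a flat floor

Route `SAWDefectDecoherence`, crux `BoundaryClosureR` (stmt-CriticalPhenomena-14004), line
`pick-half-plane`, wave 4 (the CONTOUR), serving `stub_halfPlaneInputs`.  Finite lattice and list
lemmas for turning a duplicate-free chain in the BOUNDARY-SITE GRAPH (lattice sites joined across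
the `𝕋`-edges dual to boundary darts other than the root) into a trail of boundary darts with the
side condition of `stub_halfPlaneInputs_boundaryBookkeepingPath` (floor darts crossed towards the
root):

* `floorSite_dart` / `floorSite_nbr` — on a flat floor WITHOUT PINCH the boundary darts at a floor
  site `(j, m)` are the two floor darts, so in the boundary-site graph without the root the floor
  splits into two dead-end corridors entered only at their far ends;
* `no_step_to_door` — a duplicate-free chain starting off a corridor never steps from the corridor
  to its door (it would have entered through the door before): floor darts are crossed TOWARDS the
  root;
* `exists_trail`, `sites_eq_of_dart`, `nodup_darts_of_nodup_sites` — a chain of sites with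
  admissible steps carries a trail of darts, pairwise distinct because a dart determines its dual
  edge.
-/

noncomputable section

open Literature.Probability.LatticeModels Literature.Probability.RandomPlanarGeometry.SAW

namespace Summit.CriticalPhenomena.SAWScalingLimit.Theorems.PickHalfPlane.BoundaryExactness

variable {Λ : Finset HexVertex}

open Summit.CriticalPhenomena.SAWScalingLimit.Theorems.PotentialExists (mem_inter_up_bottom)

/-- **The boundary darts at a floor site.** On a flat floor without pinch (`(k,m,0) ∈ Λ`,
`(k,m-1,1) ∉ Λ`, `(k,m,1) ∈ Λ` for `k < k₂`, `(k,m-1,0) ∉ Λ`), at a floor site `(j, m)` with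
`k₁ < j ≤ k₂` the only boundary darts `(v ∈ Λ, t ∉ Λ)` whose dual edge contains the site are the
two floor darts `floorEdge (j-1) m` and `floorEdge j m`. [folklore] -/
theorem floorSite_dart {m k₁ k₂ : ℤ}
    (hF : ∀ k : ℤ, k₁ ≤ k → k ≤ k₂ → ((![k, m], 0) : HexVertex) ∈ Λ ∧
      ((![k, m - 1], 1) : HexVertex) ∉ Λ ∧ (k < k₂ → ((![k, m], 1) : HexVertex) ∈ Λ) ∧
      ((![k, m - 1], 0) : HexVertex) ∉ Λ)
    {j : ℤ} (hj₁ : k₁ < j) (hj₂ : j ≤ k₂) {v t : HexVertex} (hv : v ∈ Λ) (ht : t ∉ Λ)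
    (hvt : hexGraph.Adj v t) (hxv : (![j, m] : Site 2) ∈ hexFaceVertices v)
    (hxt : (![j, m] : Site 2) ∈ hexFaceVertices t) :
    (v = (![j - 1, m], 0) ∧ t = (![j - 1, m - 1], 1)) ∨ (v = (![j, m], 0) ∧ t = (![j, m - 1], 1)) := by
  have hUj := (hF j hj₁.le hj₂).1
  have hBj := (hF j hj₁.le hj₂).2.1
  have hYj := (hF j hj₁.le hj₂).2.2.2
  have hUj1 := (hF (j - 1) (by omega) (by omega)).1
  have hBj1 := (hF (j - 1) (by omega) (by omega)).2.1
  have hMj1 : ((![j - 1, m], 1) : HexVertex) ∈ Λ := (hF (j - 1) (by omega) (by omega)).2.2.1 (by omega)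
  obtain ⟨y, i⟩ := v
  obtain ⟨y', i'⟩ := t
  have hadj := (hexGraph_adj_iff_coord y y' i i').1 hvt
  fin_cases i <;> fin_cases i' <;>
    simp only [Fin.zero_eta, Fin.mk_one, Fin.isValue, zero_ne_one, one_ne_zero, false_and,
      true_and, or_false, false_or] at hadj hxv hxt hv ht ⊢
  · -- `v` up, `t` down
    rw [mem_hexFaceVertices_zero] at hxv
    rw [mem_hexFaceVertices_one] at hxt
    simp only [site_two_eq_iff, Pi.add_apply, Pi.single_apply] at hxv hxt
    simp at hxv hxt
    have c1 : ¬ (y 0 = j ∧ y 1 = m - 1) := fun h =>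
      hYj (by rw [← eq_mk_of_coord (p := (y, (0 : Fin 2))) h.1 h.2 rfl]; exact hv)
    have c2 : ¬ (y' 0 = j - 1 ∧ y' 1 = m) := fun h =>
      ht (by rw [eq_mk_of_coord (p := (y', (1 : Fin 2))) h.1 h.2 rfl]; exact hMj1)
    have key : (y 0 = j - 1 ∧ y 1 = m ∧ y' 0 = j - 1 ∧ y' 1 = m - 1) ∨
        (y 0 = j ∧ y 1 = m ∧ y' 0 = j ∧ y' 1 = m - 1) := by omega
    rcases key with ⟨a, b, c, d⟩ | ⟨a, b, c, d⟩
    · exact Or.inl ⟨eq_mk_of_coord a b rfl, eq_mk_of_coord c d rfl⟩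
    · exact Or.inr ⟨eq_mk_of_coord a b rfl, eq_mk_of_coord c d rfl⟩
  · -- `v` down, `t` up: impossible
    exfalso
    rw [mem_hexFaceVertices_one] at hxv
    rw [mem_hexFaceVertices_zero] at hxt
    simp only [site_two_eq_iff, Pi.add_apply, Pi.single_apply] at hxv hxt
    simp at hxv hxt
    have c1 : ¬ (y 0 = j - 1 ∧ y 1 = m - 1) := fun h =>
      hBj1 (by rw [← eq_mk_of_coord (p := (y, (1 : Fin 2))) h.1 h.2 rfl]; exact hv)
    have c2 : ¬ (y 0 = j ∧ y 1 = m - 1) := fun h =>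
      hBj (by rw [← eq_mk_of_coord (p := (y, (1 : Fin 2))) h.1 h.2 rfl]; exact hv)
    have c3 : ¬ (y' 0 = j ∧ y' 1 = m) := fun h =>
      ht (by rw [eq_mk_of_coord (p := (y', (0 : Fin 2))) h.1 h.2 rfl]; exact hUj)
    have c4 : ¬ (y' 0 = j - 1 ∧ y' 1 = m) := fun h =>
      ht (by rw [eq_mk_of_coord (p := (y', (0 : Fin 2))) h.1 h.2 rfl]; exact hUj1)
    omega

/-- The two sites of the dual edge of a floor dart: a vertex of both `(k,m,0)` and `(k,m-1,1)` is
`(k, m)` or `(k+1, m)`. [folklore] -/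
theorem floorDart_sites {k m : ℤ} {q : Site 2} (hq : q ∈ hexFaceVertices ((![k, m], 0) : HexVertex))
    (hq' : q ∈ hexFaceVertices ((![k, m - 1], 1) : HexVertex)) : q = ![k, m] ∨ q = ![k + 1, m] := by
  have e1 : (![k, m - 1] : Site 2) = ![k, m] - Pi.single 1 1 := by ext i; fin_cases i <;> simp
  have e2 : (![k + 1, m] : Site 2) = ![k, m] + Pi.single 0 1 := by ext i; fin_cases i <;> simp
  rw [e1] at hq'
  rw [e2]
  exact mem_inter_up_bottom hq hq'

/-- **A dart determines its dual edge**: two steps across the same boundary dart join the same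
unordered pair of sites (the two common vertices of the two faces). [folklore] -/
theorem sites_eq_of_dart {v t : HexVertex} (hvt : hexGraph.Adj v t) {p q p' q' : Site 2}
    (hp : p ∈ hexFaceVertices v) (hp' : p ∈ hexFaceVertices t) (hq : q ∈ hexFaceVertices v)
    (hq' : q ∈ hexFaceVertices t) (hpq : p ≠ q) (gp : p' ∈ hexFaceVertices v)
    (gp' : p' ∈ hexFaceVertices t) (gq : q' ∈ hexFaceVertices v) (gq' : q' ∈ hexFaceVertices t)
    (hpq' : p' ≠ q') : s(p, q) = s(p', q') := by
  obtain ⟨a, b, hab, hI⟩ := Finset.card_eq_two.1 ((hexGraph_adj_iff v t).1 hvt).2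
  have hmem : ∀ x, x ∈ hexFaceVertices v → x ∈ hexFaceVertices t → x = a ∨ x = b := by
    intro x hx hx'
    have : x ∈ hexFaceVertices v ∩ hexFaceVertices t := Finset.mem_inter.2 ⟨hx, hx'⟩
    rw [hI] at this
    simpa using this
  rcases hmem p hp hp' with rfl | rfl <;> rcases hmem q hq hq' with rfl | rfl <;>
    rcases hmem p' gp gp' with rfl | rfl <;> rcases hmem q' gq gq' with rfl | rfl <;>
    first | exact absurd rfl hpq | exact absurd rfl hpq' | rfl | exact Sym2.eq_swap

/-- **No exit from a corridor but through its door.**  If every `R`-neighbour of a vertex of `S`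
lies in `S` or is the door `e`, `R` is symmetric, and a duplicate-free `R`-chain starts off `S`,
then the chain never steps from a vertex of `S` to the door (it would have had to enter `S`
through the door before). [folklore] -/
theorem no_step_to_door {α : Type*} [DecidableEq α] (R : α → α → Prop)
    (hR : ∀ a b, R a b → R b a) (S : α → Prop) (e : α) (hS : ∀ z, S z → ∀ q, R z q → S q ∨ q = e)
    (L : List α) (hnd : L.Nodup) (hch : L.IsChain R) (hhead : ∀ h : L ≠ [], ¬ S (L.head h))
    (A B : List α) (z : α) (hz : S z) (hL : L = A ++ z :: e :: B) : False := by
  classical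
  obtain ⟨A₁, y, B₁, hsplit, hy, hA₁⟩ :=
    exists_first_mem_split' ((A ++ [z]).filter fun x => S x) (A ++ [z])
      ⟨z, by simp, by simp [hz]⟩
  have hyS : S y := by simpa using (List.mem_filter.1 hy).2
  have hA₁S : ∀ x ∈ A₁, ¬ S x := fun x hx hSx =>
    hA₁ x hx (List.mem_filter.2 ⟨by rw [hsplit]; exact List.mem_append_left _ hx,
      by simpa using hSx⟩)
  -- `L = A₁ ++ y :: (B₁ ++ e :: B)`
  have hL' : L = A₁ ++ y :: (B₁ ++ e :: B) := by
    rw [hL, show A ++ z :: e :: B = (A ++ [z]) ++ (e :: B) by simp, hsplit]; simp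
  rcases A₁.eq_nil_or_concat' with hA0 | ⟨A₂, p, hA₂⟩
  · -- the chain starts in `S`
    subst hA0
    exact hhead (by rw [hL']; simp) (by simp [hL', hyS])
  · -- the vertex before the first visit to `S` is the door, which comes again later
    have hpy : R p y := by
      have hc : (A₂ ++ p :: y :: (B₁ ++ e :: B)).IsChain R := by
        rw [hL', hA₂] at hch; simpa using hch
      exact (List.isChain_append_cons_cons.1 hc).2.1
    have hpS : ¬ S p := hA₁S p (by rw [hA₂]; simp)
    have hpe : p = e := ((hS y hyS p (hR _ _ hpy)).resolve_left hpS)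
    rw [hL'] at hnd
    have hdis := (List.nodup_append.1 hnd).2.2
    exact hdis p (by rw [hA₂]; simp) e (by simp) hpe

/-- **A trail of darts from a chain of sites**: if consecutive sites of `p :: L` are joined by
steps with SOME admissible dart, there is a trail `T` (consecutive steps, each admissible)
following `p :: L`: it starts at `p`, ends at the last site, its steps are the consecutive pairs
of `p :: L`, and its unordered site pairs are those of `p :: L`. [folklore] -/
theorem exists_trail (P : Site 2 × Site 2 → HexVertex × HexVertex → Prop) :
    ∀ (p : Site 2) (L : List (Site 2)), (p :: L).IsChain (fun a b => ∃ d, P (a, b) d) →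
      ∃ T : List ((Site 2 × Site 2) × (HexVertex × HexVertex)),
        T.IsChain (fun st st' => st.1.2 = st'.1.1) ∧ (∀ st ∈ T, P st.1 st.2) ∧
        (T = [] ↔ L = []) ∧
        (∀ hT : T ≠ [], (T.head hT).1.1 = p ∧
          (T.getLast hT).1.2 = (p :: L).getLast (List.cons_ne_nil _ _)) ∧
        T.map (fun st => s(st.1.1, st.1.2)) = List.zipWith (fun a b => s(a, b)) (p :: L) L ∧
        (∀ st ∈ T, ∃ A B : List (Site 2), p :: L = A ++ st.1.1 :: st.1.2 :: B)
  | p, [], _ => ⟨[], List.IsChain.nil, by simp, by simp, fun h => (h rfl).elim, by simp, by simp⟩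
  | p, q :: L, hc => by
    obtain ⟨⟨d, hd⟩, hc'⟩ := List.isChain_cons_cons.1 hc
    obtain ⟨T, h1, h2, h3, h4, h5, h6⟩ := exists_trail P q L hc'
    refine ⟨((p, q), d) :: T, ?_, ?_, by simp, fun _ => ⟨rfl, ?_⟩, ?_, ?_⟩
    · rw [List.isChain_cons]
      refine ⟨fun st hst => ?_, h1⟩
      have hT : T ≠ [] := by rintro rfl; simp at hst
      rw [List.head?_eq_some_head hT, Option.mem_def, Option.some_inj] at hst
      rw [← hst]
      exact (h4 hT).1.symm
    · intro st hst
      rcases List.mem_cons.1 hst with rfl | hst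
      · exact hd
      · exact h2 st hst
    · by_cases hT : T = []
      · have hL : L = [] := h3.1 hT
        subst hL; subst hT; rfl
      · rw [List.getLast_cons hT, (h4 hT).2]; rfl
    · simp [h5]
    · intro st hst
      rcases List.mem_cons.1 hst with rfl | hst
      · exact ⟨[], L, rfl⟩
      · obtain ⟨A, B, hAB⟩ := h6 st hst
        exact ⟨p :: A, B, by rw [hAB]; rfl⟩

/-- Darts of a trail are pairwise distinct when its unordered site pairs are and the dart of a step
determines its site pair. [folklore] -/
theorem nodup_darts_of_nodup_sites (T : List ((Site 2 × Site 2) × (HexVertex × HexVertex)))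
    (hE : (T.map fun st => s(st.1.1, st.1.2)).Nodup)
    (hdet : ∀ st ∈ T, ∀ st' ∈ T, st.2 = st'.2 → s(st.1.1, st.1.2) = s(st'.1.1, st'.1.2)) :
    (T.map Prod.snd).Nodup := by
  refine List.Nodup.map_on (fun x hx y hy hxy => ?_) (hE.of_map _)
  exact List.inj_on_of_nodup_map hE hx hy (hdet x hx y hy hxy)

/-- **Neighbours of a floor site in the boundary-site graph without the root**: from the floor site
`(j, m)`, `k₁ < j ≤ k₂`, a step across a boundary dart other than the root `floorEdge ka m` leads
to `(j+1, m)` (across `floorEdge j m`, so `j ≠ ka`) or to `(j-1, m)` (across `floorEdge (j-1) m`,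
so `j - 1 ≠ ka`). [folklore] -/
theorem floorSite_nbr {m k₁ k₂ ka : ℤ}
    (hF : ∀ k : ℤ, k₁ ≤ k → k ≤ k₂ → ((![k, m], 0) : HexVertex) ∈ Λ ∧
      ((![k, m - 1], 1) : HexVertex) ∉ Λ ∧ (k < k₂ → ((![k, m], 1) : HexVertex) ∈ Λ) ∧
      ((![k, m - 1], 0) : HexVertex) ∉ Λ)
    {j : ℤ} (hj₁ : k₁ < j) (hj₂ : j ≤ k₂) {q : Site 2} {v t : HexVertex} (hv : v ∈ Λ) (ht : t ∉ Λ)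
    (hvt : hexGraph.Adj v t)
    (hroot : s(t, v) ≠ s(((![ka, m - 1], 1) : HexVertex), ((![ka, m], 0) : HexVertex)))
    (hxv : (![j, m] : Site 2) ∈ hexFaceVertices v) (hxt : (![j, m] : Site 2) ∈ hexFaceVertices t)
    (hqv : q ∈ hexFaceVertices v) (hqt : q ∈ hexFaceVertices t) (hqx : q ≠ ![j, m]) :
    (q = ![j + 1, m] ∧ j ≠ ka) ∨ (q = ![j - 1, m] ∧ j - 1 ≠ ka) := by
  rcases floorSite_dart hF hj₁ hj₂ hv ht hvt hxv hxt with ⟨rfl, rfl⟩ | ⟨rfl, rfl⟩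
  · refine Or.inr ⟨?_, fun h => hroot (by rw [h])⟩
    rcases floorDart_sites hqv hqt with h | h
    · exact h
    · simp only [sub_add_cancel] at h
      exact absurd h hqx
  · refine Or.inl ⟨?_, fun h => hroot (by rw [h])⟩
    rcases floorDart_sites hqv hqt with h | h
    · exact absurd h hqx
    · exact h

/-- **Registered sub-goal `boundaryBookkeeping_floorSiteDart`** (crux stmt-CriticalPhenomena-14004,
line `pick-half-plane`, wave 4, serving `stub_halfPlaneInputs`): the boundary darts at a floor
site of a flat floor without pinch are the two floor darts (closed form of `floorSite_dart`).
[folklore] -/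
theorem boundaryBookkeeping_floorSiteDart :
    ∀ (Λ : Finset HexVertex) (m k₁ k₂ : ℤ),
      (∀ k : ℤ, k₁ ≤ k → k ≤ k₂ → ((![k, m], 0) : HexVertex) ∈ Λ ∧
        ((![k, m - 1], 1) : HexVertex) ∉ Λ ∧ (k < k₂ → ((![k, m], 1) : HexVertex) ∈ Λ) ∧
        ((![k, m - 1], 0) : HexVertex) ∉ Λ) →
    ∀ (j : ℤ), k₁ < j → j ≤ k₂ → ∀ (v t : HexVertex), v ∈ Λ → t ∉ Λ → hexGraph.Adj v t →
      (![j, m] : Site 2) ∈ hexFaceVertices v → (![j, m] : Site 2) ∈ hexFaceVertices t →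
      (v = (![j - 1, m], 0) ∧ t = (![j - 1, m - 1], 1)) ∨ (v = (![j, m], 0) ∧ t = (![j, m - 1], 1)) :=
  fun _ _ _ _ hF _ hj₁ hj₂ _ _ hv ht hvt hxv hxt => floorSite_dart hF hj₁ hj₂ hv ht hvt hxv hxt


end Summit.CriticalPhenomena.SAWScalingLimit.Theorems.PickHalfPlane.BoundaryExactness
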